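import Summits.BirchSwinnertonDyer.BirchSwinnertonDyer.Theses.ShadowIsolation

/-!
# BirchSwinnertonDyer / ShadowIsolation — support item `CruxesToTarget` (stmt-BirchSwinnertonDyer-15492)

`CruxesToTarget`: the glue `IsolationOfAccidentalZeros → PhantomShadow → ShaUnboundedOfCorank → SelmerRankUB →
SelmerRankLB → SelmerRankSmallImage → ShadowIsolationThesis` (contrapositive: a positive `Ш`-corank gives
elements of all orders `p ^ n`, `PhantomShadow` gives accidental zeros at every depth, contradicting
`IsolationOfAccidentalZeros`; Selmer-BSD by the surjective / non-surjective case split).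
Candidate proof prepared by lead c3 of crux stmt-BirchSwinnertonDyer-15277 (the body is the corresponding
step of the route's certified deciding theorem `closes`, extracted verbatim; `lean check` rc 0, sorries 0,
axioms `propext`/`Classical.choice`/`Quot.sound`). Only import: the route file.
-/

-- D-0017: single-problem summit, so `Summit.BirchSwinnertonDyer.BirchSwinnertonDyer.…` repeats a
-- namespace BY DESIGN.
set_option linter.dupNamespace false

namespace Summit.BirchSwinnertonDyer.BirchSwinnertonDyer.Theorems

open scoped BigOperators Topology Classical
open Filter Set Function
open Literature
open Summit.BirchSwinnertonDyer.BirchSwinnertonDyer.Theses.ShadowIsolation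

/-- **`CruxesToTarget` (stmt-BirchSwinnertonDyer-15492).** The glue cruxes → target:
`IsolationOfAccidentalZeros → PhantomShadow → ShaUnboundedOfCorank → SelmerRankUB → SelmerRankLB →
SelmerRankSmallImage → ShadowIsolationThesis`. [cite: Greenberg1999LNM, §1 pp. 54–57] -/
theorem cruxesToTarget_proof : CruxesToTarget := by
    intro hIso hSh hAlg hUB hLB hSI W _ _ p _ h5 hgood hord hirr
    refine ⟨?_, ?_⟩
    · by_contra hne
      obtain ⟨n₀, hn₀⟩ := hIso W p h5 hgood hord hirr
      obtain ⟨σ, hσ⟩ := hAlg W p hne (max n₀ 1)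
      exact hn₀ (max n₀ 1) (le_max_left _ _)
        (hSh W p h5 hgood hord hirr (max n₀ 1) (le_max_right _ _) ⟨σ, hσ⟩)
    · by_cases hsurj : W.HasSurjectiveModNGaloisRep p
      · exact le_antisymm (hUB W p h5 hgood hord hsurj) (hLB W p h5 hgood hord hsurj)
      · exact hSI W p h5 hgood hord hsurj

end Summit.BirchSwinnertonDyer.BirchSwinnertonDyer.Theorems
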